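import Summits.Ventures.PercRepro0.ZhangChains
import Summits.Ventures.PercRepro0.Potential

/-!
# ZHANG SEPARATION in Lean: P9-separation-p1-v1 Lemma 4.1 in p2's interface (seat p1, gen 2)

Lean twin, on the cell's `Defs.lean`, of the combinatorial separation lemma of P9-separation-p1-v1 §4
(Lemma 4.1, «the closed box separates the two dual arms from the left–right connection»), OFF the
declaration path (lead 23:00:52Z), in the ψ-coordinates of `DualMap.lean` and EXACTLY in the interface
`Zhang.ZhangSeparation` of p2's `ZhangArms.lean` (INBOX 2026-08-26T00:46:30Z; fixed by the lead 00:59:29Z).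

The statement: `1 ≤ n`, `n + 2 ≤ N`, every bond of `E_n^+` closed in `ω`, an open path inside `Λ_{N−1}` from
`L_n` to `R_n`, and open dual arms (paths of `dualConfig ω` using no pair of `ψ̂(E(Λ*_n))`) from `ψ(T*_n)` and
from `ψ(B*_n)` to `ψ(∂Λ*_N)` cannot coexist.

The proof is the parity argument of P9 §4 carried by the column-count potential of `Potential.lean` instead
of the closed dual walk of the paper (no walk around the outside of the box is needed):

* `γ` = the left–right connection as a PATH (`bypass`); `σ` = a path from the same two ends `vL`, `vR` made of
  bonds of `E_n^+` (left spoke, row of `vL`, column `n`, right spoke — the «spokes ∪ π» of the paper), which exists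
  because the closed box is an arbitrary finite set of bonds (`exists_chain_boxPlusBonds`); `γ` and `σ` are
  edge-disjoint (open versus closed), so `γ · σ⁻¹` is a closed TRAIL and its edge set `C` has all degrees EVEN
  (`IsTrail.even_countP_edges_iff`);
* the dual walk `δ = arm_T⁻¹ · connector · arm_B` from `ψ(∂Λ*_N)` to `ψ(∂Λ*_N)`, where the connector joins the
  two dual arms through the closed box (top row of `ψ(Λ*_n)`, then straight down; `exists_chain_dualBoxBonds`);
  (★) of `Potential.lean` holds at every step of `δ` because `C` is even (`star_of_adj`), so
  `pot C (start) + pot C (end) + cr(δ, C)` is even (`even_pot_add_crossCount`);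
* `pot C` is even at both ends (`even_pot_of_dualBoundary`: on `ψ(∂Λ*_N)` the column count is `0` or a
  half-plane boundary count of an even edge set contained in `E(Λ_{N−1})`);
* the arms cross no bond of `C` (a dual-open step crosses a closed bond, never one of `γ`; an arm step off
  `ψ̂(E(Λ*_n))` crosses no bond of `E_n^+`, never one of `σ` — `dualEdge_mem_boxPlusBonds_iff`); the connector
  crosses no bond of `γ` (it crosses only bonds of `E_n^+`, all closed), and it crosses the bonds of `σ` an ODD
  number of times — a second telescoping of the potential of `E(σ)` alone along the connector: the potential is
  `0` at `ψ(B*_n)` and ODD at `ψ(T*_n)` (the half-plane count whose only odd vertex is `vL`), and (★) holds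
  along the connector since the columns of its vertical lattice steps lie in `[−n, n]`, away from the odd
  vertices `vL`, `vR` of `E(σ)` — no explicit edge set of `σ` is ever needed.

Hence `cr(δ, C)` is both even and odd: contradiction. `theorem zhangSeparation_holds : Zhang.ZhangSeparation`.
The chain/walk conversions and the two explicit connectors are in `ZhangChains.lean`.

Imports only landed PercRepro0 modules (which import Mathlib). No definitions, no instances, no axioms.
-/

namespace Summit.Ventures.PercRepro0.ZhangSeparation

open Summit.Ventures.PercRepro0.Defs Summit.Ventures.PercRepro0.Crossing
  Summit.Ventures.PercRepro0.DualMap Summit.Ventures.PercRepro0.EdgeParity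
  Summit.Ventures.PercRepro0.Potential Summit.Ventures.PercRepro0.Zhang
  Summit.Ventures.PercRepro0.ZhangChains
open scoped Classical

/-! ## A coordinate fact -/

/-- A horizontal bond of `E_n^+` has height `|y| ≤ n`. -/
theorem abs_le_of_hb_mem_boxPlusBonds {n : ℕ} {c y : ℤ} (h : hb c y ∈ boxPlusBonds n) : |y| ≤ n := by
  rw [hb, pair_mem_boxPlusBonds (h_mem_bonds c y), mem_box_two, mem_box_two] at h
  simp only [pt_zero, pt_one] at h
  rcases h with ⟨-, h⟩ | ⟨-, h⟩ <;> exact h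

/-! ## Degrees of the edge set of a trail -/

/-- The degree of `z` in the edge set of a trail is the number of its edges containing `z`. -/
theorem edeg_toFinset_eq_countP {u v : Vertex 2} (p : (lattice 2).Walk u v) (hp : p.IsTrail) (z : Vertex 2) :
    edeg p.edges.toFinset z = p.edges.countP (fun e => decide (z ∈ e)) := by
  rw [edeg, List.countP_eq_length_filter, ← List.toFinset_card_of_nodup (hp.edges_nodup.filter _),
    List.toFinset_filter]
  congr 1
  refine Finset.filter_congr fun e _ => ?_
  simp

/-- The odd-degree vertices of a trail with distinct ends are exactly its two ends. -/
theorem odd_edeg_iff {u v : Vertex 2} (p : (lattice 2).Walk u v) (hp : p.IsTrail) (huv : u ≠ v)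
    (z : Vertex 2) : Odd (edeg p.edges.toFinset z) ↔ z = u ∨ z = v := by
  rw [edeg_toFinset_eq_countP p hp, ← Nat.not_even_iff_odd, hp.even_countP_edges_iff]
  constructor
  · intro h
    by_contra hcon
    exact h fun _ => ⟨fun h' => hcon (Or.inl h'), fun h' => hcon (Or.inr h')⟩
  · rintro (rfl | rfl) h
    · exact (h huv).1 rfl
    · exact (h huv).2 rfl

/-- The edge set of a CLOSED trail has all degrees even. -/
theorem even_edeg_of_closed {u : Vertex 2} (p : (lattice 2).Walk u u) (hp : p.IsTrail) (z : Vertex 2) :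
    Even (edeg p.edges.toFinset z) := by
  rw [edeg_toFinset_eq_countP p hp]
  exact (hp.even_countP_edges_iff z).2 fun h => absurd rfl h

/-! ## (★) from the adjacency, and the crossing count of a concatenation -/

/-- **(★) across one lattice step**, from the adjacency: for a horizontal lattice step unconditionally, for a
vertical lattice step `(a, b) ↔ (a, b+1)` provided every vertex of the half-column `{(b+1, y) : y < a}` has even
degree in `C` (`even_step_h` / `even_step_v` of `Potential.lean`). -/
theorem star_of_adj (C : Finset (Sym2 (Vertex 2))) (hC : ∀ e ∈ C, e ∈ bonds 2) {x y : Vertex 2}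
    (hadj : (lattice 2).Adj x y)
    (heven : x 0 = y 0 → ∀ z : Vertex 2, z 0 = max (x 1) (y 1) → z 1 < x 0 → Even (edeg C z)) :
    Even (pot C x + pot C y + (if dualEdge s(x, y) ∈ C then 1 else 0)) := by
  have hb : s(x, y) ∈ bonds 2 := hadj
  rw [mem_bonds_iff] at hb
  rcases hb with ⟨h1, h0⟩ | ⟨h0, h1⟩
  · rcases (abs_eq (zero_le_one' ℤ)).1 h0 with h | h
    · -- y = x − e₀
      have hx' : x = pt (y 0 + 1) (y 1) := eq_pt_of (by omega) (by omega)
      have hy' : y = pt (y 0) (y 1) := eq_pt y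
      rw [hx', hy', Sym2.eq_swap, add_comm (pot C _) (pot C _)]
      exact even_step_h C (y 0) (y 1)
    · -- y = x + e₀
      have hx' : x = pt (x 0) (x 1) := eq_pt x
      have hy' : y = pt (x 0 + 1) (x 1) := eq_pt_of (by omega) (by omega)
      rw [hx', hy']
      exact even_step_h C (x 0) (x 1)
  · rcases (abs_eq (zero_le_one' ℤ)).1 h1 with h | h
    · -- y = x − e₁: the half-column is the column `x 1 = y 1 + 1`
      have hx' : x = pt (y 0) (y 1 + 1) := eq_pt_of (by omega) (by omega)
      have hy' : y = pt (y 0) (y 1) := eq_pt y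
      have hmax : max (x 1) (y 1) = y 1 + 1 := by rw [max_eq_left (by omega)]; omega
      rw [hx', hy', Sym2.eq_swap, add_comm (pot C _) (pot C _)]
      refine even_step_v C hC (y 0) (y 1) fun z hz0 hz1 => heven h0 z (by rw [hmax]; exact hz0) (by omega)
    · -- y = x + e₁: the half-column is the column `y 1 = x 1 + 1`
      have hx' : x = pt (x 0) (x 1) := eq_pt x
      have hy' : y = pt (x 0) (x 1 + 1) := eq_pt_of (by omega) (by omega)
      have hmax : max (x 1) (y 1) = x 1 + 1 := by rw [max_eq_right (by omega)]; omega
      rw [hx', hy']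
      refine even_step_v C hC (x 0) (x 1) fun z hz0 hz1 => heven h0 z (by rw [hmax]; exact hz0) hz1

/-- The crossing count of a concatenation is the sum. -/
theorem crossCount_append (C : Finset (Sym2 (Vertex 2))) {u v w : Vertex 2} (p : (lattice 2).Walk u v)
    (q : (lattice 2).Walk v w) : crossCount C (p.append q) = crossCount C p + crossCount C q := by
  simp only [crossCount, SimpleGraph.Walk.edges_append, List.countP_append]

/-- A walk none of whose steps crosses a bond of `C` has crossing count `0`. -/
theorem crossCount_eq_zero (C : Finset (Sym2 (Vertex 2))) {u v : Vertex 2} (p : (lattice 2).Walk u v)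
    (h : ∀ e ∈ p.edges, dualEdge e ∉ C) : crossCount C p = 0 := by
  rw [crossCount, List.countP_eq_zero]
  intro e he
  rw [decide_eq_true_eq]
  exact h e he

/-- Two edge sets crossed identically along a walk have the same crossing count. -/
theorem crossCount_congr (C C' : Finset (Sym2 (Vertex 2))) {u v : Vertex 2} (p : (lattice 2).Walk u v)
    (h : ∀ e ∈ p.edges, dualEdge e ∈ C ↔ dualEdge e ∈ C') : crossCount C p = crossCount C' p := by
  rw [crossCount, crossCount, List.countP_eq_length_filter, List.countP_eq_length_filter]
  congr 1
  refine List.filter_congr fun e he => ?_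
  simp only [decide_eq_decide]
  exact h e he

/-! ## The potential at the ends of the dual walk -/

/-- **The potential of an even edge set inside `Λ_{N−1}` is even on `ψ(∂Λ*_N)`**: on the top side it is the
half-plane boundary count (`bdryCount_halfPlane` + `even_bdryCount_iff`, no odd vertex), on the other three
sides the column count is `0`. -/
theorem even_pot_of_dualBoundary {N : ℕ} (hN : 1 ≤ N) (C : Finset (Sym2 (Vertex 2)))
    (hC : ∀ e ∈ C, e ∈ bonds 2) (hbox : ∀ e ∈ C, ∀ v ∈ e, v ∈ box 2 (N - 1))
    (heven : ∀ z, Even (edeg C z)) {y : Vertex 2} (hy : y ∈ dualBoundary N) : Even (pot C y) := by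
  have hN' : ((N - 1 : ℕ) : ℤ) = (N : ℤ) - 1 := by omega
  have hhb : ∀ c h : ℤ, hb c h ∈ C → (|c| ≤ (N : ℤ) - 1 ∧ |c + 1| ≤ (N : ℤ) - 1) ∧ |h| ≤ (N : ℤ) - 1 := by
    intro c h hmem
    have h1 := hbox _ hmem (pt c h) (by rw [hb, Sym2.mem_iff]; exact Or.inl rfl)
    have h2 := hbox _ hmem (pt (c + 1) h) (by rw [hb, Sym2.mem_iff]; exact Or.inr rfl)
    rw [mem_box_two, hN'] at h1 h2
    simp only [pt_zero, pt_one] at h1 h2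
    exact ⟨⟨h1.1, h2.1⟩, h1.2⟩
  obtain ⟨⟨hy0, hy1, hy2, hy3⟩, hcase⟩ := dualBoundary_cases hy
  rcases hcase with h | h | h | h
  · -- top side: `y 0 = N + 1`, the half-plane count
    rw [pot, h, ← bdryCount_halfPlane C hC (y 1) ((N : ℤ) + 1) (fun h' hh' => by
      have := (hhb _ _ hh').2
      rw [abs_le] at this
      omega)]
    rw [even_bdryCount_iff C (fun e he => SimpleGraph.not_isDiag_of_mem_edgeSet _ (hC e he))]
    have hfilter : (vertsIn C (halfPlane (y 1))).filter (fun z => Odd (edeg C z)) = ∅ := by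
      rw [Finset.filter_eq_empty_iff]
      intro z _ hodd
      exact (Nat.not_even_iff_odd.2 hodd) (heven z)
    rw [hfilter, Finset.card_empty]
    exact ⟨0, rfl⟩
  · -- bottom side: `y 0 = −N`, nothing below
    rw [pot, h, W_eq_zero C _ _ (fun h' hh' hmem => by
      have := (hhb _ _ hmem).2
      rw [abs_le] at this
      omega)]
    exact ⟨0, rfl⟩
  · -- right side: `y 1 = N`, no bond in the column `N`
    rw [pot, h, W_eq_zero C _ _ (fun h' _ hmem => by
      have := (hhb _ _ hmem).1.2
      rw [abs_le] at this
      omega)]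
    exact ⟨0, rfl⟩
  · -- left side: `y 1 = −(N+1)`, no bond in the column `−(N+1)`
    rw [pot, h, W_eq_zero C _ _ (fun h' _ hmem => by
      have := (hhb _ _ hmem).1.1
      rw [abs_le] at this
      omega)]
    exact ⟨0, rfl⟩

/-! ## The theorem -/

/-- **ZHANG SEPARATION** (P9-separation-p1-v1 Lemma 4.1 in ψ-coordinates), in the interface of p2's
`ZhangArms.lean`: `Zhang.ZhangSeparation` holds. Proof by the column-count potential of `Potential.lean`
(see the module docstring). -/
theorem zhangSeparation_holds : ZhangSeparation := by
  intro n N ω hn hN hclosed hΓ hT hB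
  obtain ⟨vL, hvL, vR, hvR, hγ⟩ := hΓ
  obtain ⟨t, ht, yT, hyT, harmT⟩ := hT
  obtain ⟨b, hb, yB, hyB, harmB⟩ := hB
  have hN1 : 1 ≤ N := by omega
  have hNn : ((N - 1 : ℕ) : ℤ) = (N : ℤ) - 1 := by omega
  -- the four lattice walks
  obtain ⟨γ0, hγ0⟩ := exists_walk_of_reflTransGen
    (P := fun e => e ∈ ω ∧ ∀ v ∈ e, v ∈ box 2 (N - 1))
    (fun x y h => by
      unfold InAdj at h
      refine ⟨h.1, h.2.1, fun v hv => ?_⟩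
      rcases Sym2.mem_iff.1 hv with rfl | rfl
      · exact h.2.2.1
      · exact h.2.2.2) hγ
  obtain ⟨σ0, hσ0⟩ := exists_walk_of_reflTransGen (P := fun e => e ∈ boxPlusBonds n) (fun x y h => h)
    (exists_chain_boxPlusBonds hvL hvR)
  obtain ⟨wT, hwT⟩ := exists_walk_of_reflTransGen
    (P := fun e => e ∈ dualConfig ω ∧ e ∉ dualBoxBonds n)
    (fun x y h => by unfold DOffAdj DAdj at h; exact ⟨h.1, h.2.1, h.2.2⟩)
    (reflTransGen_swap (symmetric_dOffAdj n ω) harmT)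
  obtain ⟨wB, hwB⟩ := exists_walk_of_reflTransGen
    (P := fun e => e ∈ dualConfig ω ∧ e ∉ dualBoxBonds n)
    (fun x y h => by unfold DOffAdj DAdj at h; exact ⟨h.1, h.2.1, h.2.2⟩) harmB
  obtain ⟨conn, hconn⟩ := exists_walk_of_reflTransGen (P := fun e => e ∈ dualBoxBonds n) (fun x y h => h)
    (exists_chain_dualBoxBonds ht hb)
  -- the two paths and the even edge set `C`
  set γ := γ0.bypass with hγdef
  set σ := σ0.bypass with hσdef
  have hγpath : γ.IsPath := γ0.bypass_isPath
  have hσpath : σ.IsPath := σ0.bypass_isPath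
  have hγE : ∀ e ∈ γ.edges, e ∈ ω ∧ ∀ v ∈ e, v ∈ box 2 (N - 1) := fun e he =>
    hγ0 e (γ0.edges_bypass_subset_edges he)
  have hσE : ∀ e ∈ σ.edges, e ∈ boxPlusBonds n := fun e he => hσ0 e (σ0.edges_bypass_subset_edges he)
  have hvLR : vL ≠ vR := by
    intro h
    have h1 := hvL.1
    have h2 := hvR.1
    rw [h] at h1
    omega
  have htrail : (γ.append σ.reverse).IsTrail := by
    rw [SimpleGraph.Walk.isTrail_def, SimpleGraph.Walk.edges_append, SimpleGraph.Walk.edges_reverse,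
      List.nodup_append]
    refine ⟨hγpath.isTrail.edges_nodup, List.nodup_reverse.2 hσpath.isTrail.edges_nodup, ?_⟩
    intro e heγ e' heσ heq
    subst heq
    rw [List.mem_reverse] at heσ
    exact hclosed e (hσE e heσ) (hγE e heγ).1
  set C := (γ.append σ.reverse).edges.toFinset with hCdef
  have hCmem : ∀ e, e ∈ C ↔ e ∈ γ.edges ∨ e ∈ σ.edges := by
    intro e
    simp only [hCdef, List.mem_toFinset, SimpleGraph.Walk.edges_append, SimpleGraph.Walk.edges_reverse,
      List.mem_append, List.mem_reverse]
  have hCeven : ∀ z, Even (edeg C z) := even_edeg_of_closed _ htrail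
  have hCbonds : ∀ e ∈ C, e ∈ bonds 2 := fun e he =>
    (γ.append σ.reverse).edges_subset_edgeSet (List.mem_toFinset.1 he)
  have hCbox : ∀ e ∈ C, ∀ v ∈ e, v ∈ box 2 (N - 1) := by
    intro e he v hv
    rcases (hCmem e).1 he with h | h
    · exact (hγE e h).2 v hv
    · have := mem_box_succ_of_mem_boxPlusBonds (hσE e h) hv
      rw [mem_box_two] at this ⊢
      rw [hNn]
      push_cast at this
      omega
  -- the edge set of `σ` alone: odd exactly at `vL`, `vR`
  set Cσ := σ.edges.toFinset with hCσdef
  have hCσodd : ∀ z, Odd (edeg Cσ z) ↔ z = vL ∨ z = vR := odd_edeg_iff σ hσpath.isTrail hvLR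
  have hCσbonds : ∀ e ∈ Cσ, e ∈ bonds 2 := fun e he => σ.edges_subset_edgeSet (List.mem_toFinset.1 he)
  have hCσbox : ∀ e ∈ Cσ, e ∈ boxPlusBonds n := fun e he => hσE e (List.mem_toFinset.1 he)
  -- the dual walk and its telescoped parity
  set δ := wT.append (conn.append wB) with hδdef
  have hstep : ∀ x y : Vertex 2, s(x, y) ∈ δ.edges →
      Even (pot C x + pot C y + (if dualEdge s(x, y) ∈ C then 1 else 0)) := fun x y hxy =>
    star_of_adj C hCbonds (δ.edges_subset_edgeSet hxy) fun _ z _ _ => hCeven z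
  have htel := even_pot_add_crossCount C δ hstep
  have hyTeven : Even (pot C yT) := even_pot_of_dualBoundary hN1 C hCbonds hCbox hCeven hyT
  have hyBeven : Even (pot C yB) := even_pot_of_dualBoundary hN1 C hCbonds hCbox hCeven hyB
  -- the arms cross nothing of `C`
  have harm : ∀ {u v : Vertex 2} (w : (lattice 2).Walk u v),
      (∀ e ∈ w.edges, e ∈ dualConfig ω ∧ e ∉ dualBoxBonds n) → crossCount C w = 0 := by
    intro u v w hw
    refine crossCount_eq_zero C w fun e he hmem => ?_
    obtain ⟨hopen, hoff⟩ := hw e he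
    rcases (hCmem _).1 hmem with h | h
    · exact ((mem_dualConfig ω e).1 hopen).2 (hγE _ h).1
    · exact hoff ((dualEdge_mem_boxPlusBonds_iff (w.edges_subset_edgeSet he)).1 (hσE _ h))
  have hcrT : crossCount C wT = 0 := harm wT hwT
  have hcrB : crossCount C wB = 0 := harm wB hwB
  -- the connector crosses only bonds of `σ`, an odd number of times
  have hconnC : crossCount C conn = crossCount Cσ conn := by
    refine crossCount_congr C Cσ conn fun e he => ?_
    rw [hCmem, hCσdef, List.mem_toFinset]
    constructor
    · rintro (h | h)
      · exfalso
        exact hclosed _ ((dualEdge_mem_boxPlusBonds_iff (conn.edges_subset_edgeSet he)).2 (hconn e he))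
          (hγE _ h).1
      · exact h
    · exact Or.inr
  have hstepσ : ∀ x y : Vertex 2, s(x, y) ∈ conn.edges →
      Even (pot Cσ x + pot Cσ y + (if dualEdge s(x, y) ∈ Cσ then 1 else 0)) := by
    intro x y hxy
    have hadj := (mem_bonds_iff x y).1 (conn.edges_subset_edgeSet hxy)
    refine star_of_adj Cσ hCσbonds (conn.edges_subset_edgeSet hxy) fun hxy0 z hz0 _ => ?_
    rw [← Nat.not_odd_iff_even, hCσodd]
    have hmem := hconn _ hxy
    rw [pair_mem_dualBoxBonds, mem_dualBox, mem_dualBox] at hmem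
    have hvL0 := hvL.1
    have hvR0 := hvR.1
    rw [max_def] at hz0
    rcases hadj with ⟨h1, h0⟩ | ⟨h0, h1⟩
    · exfalso
      rcases (abs_eq (zero_le_one' ℤ)).1 h0 with h | h <;> omega
    · rcases (abs_eq (zero_le_one' ℤ)).1 h1 with h | h <;> rintro (rfl | rfl) <;> split_ifs at hz0 <;> omega
  have htelσ := even_pot_add_crossCount Cσ conn hstepσ
  have hpotB : pot Cσ b = 0 := by
    rw [pot, hb.1]
    refine W_eq_zero Cσ _ _ fun h hh hmem => ?_
    have := abs_le_of_hb_mem_boxPlusBonds (hCσbox _ hmem)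
    rw [abs_le] at this
    omega
  have hpotT : Odd (pot Cσ t) := by
    rw [pot, ht.1, ← bdryCount_halfPlane Cσ hCσbonds (t 1) ((n : ℤ) + 1) (fun h hh => by
      have := abs_le_of_hb_mem_boxPlusBonds (hCσbox _ hh)
      rw [abs_le] at this
      omega)]
    rw [← Nat.not_even_iff_odd, even_bdryCount_iff Cσ
      (fun e he => SimpleGraph.not_isDiag_of_mem_edgeSet _ (hCσbonds e he))]
    have hfilter : (vertsIn Cσ (halfPlane (t 1))).filter (fun z => Odd (edeg Cσ z)) = {vL} := by
      ext z
      simp only [Finset.mem_filter, mem_vertsIn, Finset.mem_singleton, hCσodd, halfPlane, Set.mem_setOf_eq]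
      constructor
      · rintro ⟨⟨-, hz⟩, hzL | hzR⟩
        · exact hzL
        · exfalso
          have := hvR.1
          have := ht.2.2
          rw [hzR] at hz
          omega
      · intro hzL
        rw [hzL]
        refine ⟨⟨?_, by rw [hvL.1]; exact ht.2.1⟩, Or.inl rfl⟩
        have hpos : 0 < edeg Cσ vL := Nat.pos_of_ne_zero (by
          intro h0
          have := (hCσodd vL).2 (Or.inl rfl)
          rw [h0] at this
          exact (Nat.not_even_iff_odd.2 this) ⟨0, rfl⟩)
        exact exists_mem_of_edeg_pos Cσ vL hpos
    rw [hfilter, Finset.card_singleton]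
    decide
  -- assemble the contradiction
  have hδcr : crossCount C δ = crossCount C wT + (crossCount C conn + crossCount C wB) := by
    rw [hδdef, crossCount_append, crossCount_append]
  obtain ⟨a, ha⟩ := htel
  obtain ⟨a1, ha1⟩ := hyTeven
  obtain ⟨a2, ha2⟩ := hyBeven
  obtain ⟨c, hc⟩ := htelσ
  obtain ⟨m, hm⟩ := hpotT
  rw [hδcr, hcrT, hcrB, hconnC, ha1, ha2] at ha
  rw [hpotB, hm] at hc
  omega

end Summit.Ventures.PercRepro0.ZhangSeparation
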